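import Mathlib
import Summits.Ventures.HodgeRepro.Tier4.Target
import Summits.Ventures.HodgeRepro.Tier4.Common.TargetBall
import Summits.Ventures.HodgeRepro.Tier4.Line3.Defs
import Summits.Ventures.HodgeRepro.Tier4.Line3.LocaliserS
import Summits.Ventures.HodgeRepro.Tier4.Line3.HeckeEquivarianceLemmas
import Summits.Ventures.HodgeRepro.Tier4.Line3.OffMainInvariance
import Summits.Ventures.HodgeRepro.Tier4.Line3.CongruenceIndex
import Summits.Ventures.HodgeRepro.Tier4.Line3.InvariantMajorantDef
import Summits.Ventures.HodgeRepro.Tier4.Line3.InvariantClassBound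
import Summits.Ventures.HodgeRepro.Tier4.Line3.InvariantRouteAssembly
import Summits.Ventures.HodgeRepro.Tier4.Line3.RayMinor
import Summits.Ventures.HodgeRepro.Tier4.Line3.RayClassBound
import Summits.Ventures.HodgeRepro.Tier4.Line3.CrossMinor
import Summits.Ventures.HodgeRepro.Tier4.Line3.FamilyClassBound
import Summits.Ventures.HodgeRepro.Tier4.Line3.OffSetMass
import Summits.Ventures.HodgeRepro.Tier4.Line3.OffSetMassExp

/-!
# Tier4/Line3/FamilyAssembly — L3.5 OFF THE CROSS FAMILY: the majorant route assembled on the per-slot clause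

Blind re-derivation cell `pub-hodge-repro`, Tier 4 «PROVE THE STEP» (README §9–§10), LINE L3, lemma L3.5
`term_dominated`; seat t4-L2-p3 (gen 3).  The assembly of the family route (bus S13403 / S13458): on a bare pair
`(level, loc)` with the per-slot support clause `SuppSlot`, the growth clause `GrowthInvOn`, a `Γ`-stable set `S′`
containing the support, a fundamental domain `F` of `Γ` and the finite mass of the invariant majorant density over
`F` — exactly the inputs of the landed `term_dominated_of_growthInv` (p674244) — the orbital terms OFF THE CROSS FAMILY
have one summable majorant, uniform in the depth:

* `familySet S′ xm` = the off-family part of `S′`; `familyMajorantDensity` = the invariant majorants summed over it;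
  it is `Γ`-invariant (`familyMajorantDensity_isInvariant`) and dominated termwise by the landed
  `invMajorantDensity` (off-family ⊆ off-main, the main orbit being in the family) — so x2's theta mass (p674650) and
  t4-L2-p2's bridge (p674919) apply UNCHANGED;
* `offFamilyDensity_le_familyMajorantDensity`: the pointwise bound from `FamilyClassBound`;
* `offFamilyMass_of_growthInvOn`: the `OffSetMassExp` with root `1/(2d)` through the glue `OffSetMassExp`;
* **`term_dominated_family`**: `∃ bound, (∀ o, 0 ≤ bound o) ∧ Summable bound ∧ ∀ N o, o ∉ CrossFamily xm →
  ‖term (level N) (loc N) o‖ ≤ bound o`.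

What is NOT here: the `Γ`-stable support lattice from `SuppSlot` (t4-L2-p1's per-slot `exists_stable_lattice_suppU_slot`,
held per lead S13430) — `term_dominated_family` displays `hS`, `hsuppIn` instead, exactly as `term_dominated_of_growthInv`
did before `InvariantSupportSet`; the `_lit` composition follows the moment that module serves.  No printed input is
consumed; nothing here asserts anything about the truth of (P); HC_CM is NOT proved by anyone in this repository.
-/

set_option autoImplicit false

noncomputable section

namespace Summit.Ventures.HodgeRepro.Tier4.Line3

open Summit.Ventures.HodgeRepro.Tier4
open Matrix MeasureTheory NumberField
open scoped ENNReal
open HeckeEquivariance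

namespace T4Data

variable (X : T4Data)

/-! ### 1. The off-family part of a `Γ`-stable set and its majorant density -/

/-- The off-family part of `S′`. -/
def familySet (S' : Set X.LineTuple) (xm : X.Tuple) : Set X.LineTuple :=
  {w | w ∈ S' ∧ X.orbitOf w ∉ X.CrossFamily xm}

/-- **THE FAMILY MAJORANT DENSITY**: the invariant majorants summed over the off-family line tuples of `S′`. -/
def familyMajorantDensity (D : X.ThetaData) (S' : Set X.LineTuple) (xm : X.Tuple) (e c₁ : ℝ) (z : Fin 2 → ℂ) :
    ℝ≥0∞ :=
  ∑' w : X.familySet S' xm, ENNReal.ofReal (X.invMajorant D e c₁ w.1 z)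

/-- The off-family part of a `Γ`-stable set is stable under `γ ·` and its inverse (`γ ∈ Γ`). -/
theorem mem_familySet_tupleEquivOf_iff {S' : Set X.LineTuple} (hS : X.IsGammaStable S') (xm : X.Tuple)
    {γ : Matrix (Fin 3) (Fin 3) X.E} (hγ : γ ∈ X.Γ) (hdet : IsUnit γ.det) (w : X.LineTuple) :
    tupleEquivOf X γ hdet w ∈ X.familySet S' xm ↔ w ∈ X.familySet S' xm := by
  have hγu : IsUnitaryOf X.c X.H γ := isUnitaryOf_of_mem_congruence X.hΓ hγ
  obtain ⟨γ', hγ', _, hγ'γ⟩ := exists_two_sided_inv_mem X.c X.H X.hΓ hγ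
  unfold familySet
  simp only [Set.mem_setOf_eq]
  rw [orbitOf_tupleEquivOf X hγu hdet w]
  constructor
  · rintro ⟨h1, h2⟩
    refine ⟨?_, h2⟩
    have h := hS γ' hγ' (fun j => γ *ᵥ X.rep w j) (by rwa [lines_mulVec_rep X γ hdet w])
    have hx : (fun j => γ' *ᵥ (γ *ᵥ X.rep w j)) = X.rep w := by
      funext j
      rw [Matrix.mulVec_mulVec, hγ'γ, Matrix.one_mulVec]
    rw [hx, X.lines_rep w] at h
    exact h
  · rintro ⟨h1, h2⟩
    refine ⟨?_, h2⟩
    rw [← lines_mulVec_rep X γ hdet w]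
    exact hS γ hγ (X.rep w) (by rwa [X.lines_rep w])

/-- The bijection `w ↦ γ · w` of the off-family tuples of a `Γ`-stable set. -/
def familySetEquiv {S' : Set X.LineTuple} (hS : X.IsGammaStable S') (xm : X.Tuple)
    {γ : Matrix (Fin 3) (Fin 3) X.E} (hγ : γ ∈ X.Γ) (hdet : IsUnit γ.det) :
    X.familySet S' xm ≃ X.familySet S' xm :=
  (tupleEquivOf X γ hdet).subtypeEquiv fun w => (X.mem_familySet_tupleEquivOf_iff hS xm hγ hdet w).symm

/-- **THE FAMILY MAJORANT DENSITY IS `Γ`-INVARIANT** as a `|det Jac|²`-density. -/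
theorem familyMajorantDensity_isInvariant (D : X.ThetaData) {S' : Set X.LineTuple} (hS : X.IsGammaStable S')
    (xm : X.Tuple) (e c₁ : ℝ) :
    IsInvariantDensity X.τ₀ X.C X.Γ (X.familyMajorantDensity D S' xm e c₁) := by
  rintro φ ⟨γ, hγ, rfl⟩ z hz
  have hγu : IsUnitaryOf X.c X.H γ := isUnitaryOf_of_mem_congruence X.hΓ hγ
  have hdet : IsUnit γ.det := isUnit_det_of_isUnitaryOf X hγu
  unfold familyMajorantDensity
  rw [← ENNReal.tsum_mul_left, ← (X.familySetEquiv hS xm hγ hdet).tsum_eq]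
  refine tsum_congr fun w => ?_
  show ENNReal.ofReal (Complex.normSq (jacDetMap (actM (toBallMat X.τ₀ X.C γ)) z)) *
      ENNReal.ofReal (X.invMajorant D e c₁ (tupleEquivOf X γ hdet w.1) (actM (toBallMat X.τ₀ X.C γ) z)) =
    ENNReal.ofReal (X.invMajorant D e c₁ w.1 z)
  rw [← ENNReal.ofReal_mul (Complex.normSq_nonneg _)]
  congr 1
  rw [X.invMajorant_eq_of_lines_eq D e c₁ (lines_mulVec_rep X γ hdet w.1), X.gammaInf_mulVec e c₁ hγ]
  unfold invMajorant
  rw [← X.kerMaj_equiv D hγu (X.rep w.1) hz]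
  ring

/-- Off the family is off the main orbit (the main orbit lies in the family). -/
theorem familySet_subset_invSet (S' : Set X.LineTuple) (xm : X.Tuple) : X.familySet S' xm ⊆ X.invSet S' xm := by
  rintro w ⟨h1, h2⟩
  refine ⟨h1, fun h => h2 ?_⟩
  rw [h]
  exact X.orbitOf_lines_mem_crossFamily xm

/-- **The family majorant density is dominated by the invariant majorant density** (a sub-sum of non-negative terms),
so the landed mass bounds over `F` apply unchanged. -/
theorem familyMajorantDensity_le_invMajorantDensity (D : X.ThetaData) (S' : Set X.LineTuple) (xm : X.Tuple)
    (e c₁ : ℝ) (z : Fin 2 → ℂ) :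
    X.familyMajorantDensity D S' xm e c₁ z ≤ X.invMajorantDensity D S' xm e c₁ z := by
  unfold familyMajorantDensity invMajorantDensity
  exact ENNReal.tsum_comp_le_tsum_of_injective (Set.inclusion_injective (X.familySet_subset_invSet S' xm))
    (fun w : X.invSet S' xm => ENNReal.ofReal (X.invMajorant D e c₁ w.1 z))

/-- The off-family line tuples of `S′` (as a subtype of the off-family line tuples) are the off-family part of `S′`. -/
def familySubtypeEquiv (S' : Set X.LineTuple) (xm : X.Tuple) :
    {w : {w : X.LineTuple // X.orbitOf w ∉ X.CrossFamily xm} // w.1 ∈ S'} ≃ X.familySet S' xm :=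
  (Equiv.subtypeSubtypeEquivSubtypeInter (fun w => X.orbitOf w ∉ X.CrossFamily xm) (fun w => w ∈ S')).trans
    (Equiv.subtypeEquivRight fun w => by
      show _ ↔ w ∈ X.familySet S' xm
      unfold familySet
      rw [Set.mem_setOf_eq, and_comm])

/-- The sum over the off-family tuples of `S′` equals the `S′`-indicator summed over all off-family tuples. -/
theorem tsum_familySet_eq (S' : Set X.LineTuple) (xm : X.Tuple) (f : X.LineTuple → ℝ≥0∞) :
    ∑' v : X.familySet S' xm, f v.1 =
      ∑' w : {w : X.LineTuple // X.orbitOf w ∉ X.CrossFamily xm}, S'.indicator f w.1 := by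
  rw [← (X.familySubtypeEquiv S' xm).tsum_eq]
  have h : ∀ w : {w : X.LineTuple // X.orbitOf w ∉ X.CrossFamily xm},
      S'.indicator f w.1 = ({w : {w : X.LineTuple // X.orbitOf w ∉ X.CrossFamily xm} | w.1 ∈ S'}).indicator
        (fun w => f w.1) w := by
    intro w
    by_cases hw : w.1 ∈ S'
    · rw [Set.indicator_of_mem hw, Set.indicator_of_mem (show w ∈ {w : {w : X.LineTuple //
        X.orbitOf w ∉ X.CrossFamily xm} | w.1 ∈ S'} from hw)]
    · rw [Set.indicator_of_notMem hw, Set.indicator_of_notMem (show w ∉ {w : {w : X.LineTuple //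
        X.orbitOf w ∉ X.CrossFamily xm} | w.1 ∈ S'} from hw)]
  simp only [h]
  rw [← tsum_subtype]
  rfl

/-! ### 2. The pointwise bound, the mass and the orbit bound off the family -/

/-- **THE POINTWISE BOUND OFF THE FAMILY**: under `SuppSlot` and `GrowthInvOn`, for `S′` containing the support,
the off-family density of the depth-`N` localiser is at most `K q₂^N e^{−κ (N(𝔭)^N)^{1/(2d)}}` times the family
majorant density, on the whole ball. -/
theorem offFamilyDensity_le_familyMajorantDensity (D : X.ThetaData)
    (p : IsDedekindDomain.HeightOneSpectrum (RingOfIntegers X.E)) (xm : X.Tuple)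
    {level : ℕ → X.Level} (loc : ∀ N, X.Tr (level N))
    (hsupp : X.SuppSlot D p xm loc) (hinv : X.GrowthInvOn D loc) {S' : Set X.LineTuple}
    (hsuppIn : ∀ (N : ℕ) (w : X.LineTuple), X.coefQ D.cf (loc N) (X.rep w) ≠ 0 → w ∈ S') :
    ∃ (K q₂ κ e c₁ : ℝ), 0 < κ ∧ 0 ≤ K ∧ 0 ≤ q₂ ∧ 0 < c₁ ∧ ∀ (N : ℕ), ∀ z ∈ ball,
      X.offSetDensity D (loc N) (X.CrossFamily xm) z ≤
        ENNReal.ofReal (K * q₂ ^ N * X.offDecayAt p κ (2 * Module.finrank ℚ X.E) N) *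
          X.familyMajorantDensity D S' xm e c₁ z := by
  obtain ⟨B, q₂, e, κ, C₁, c₁, hκ, hB, hq₂, hC₁, hc₁, hclass⟩ :=
    X.summand_bound_off_family_inv D p xm loc hsupp hinv
  refine ⟨B * C₁, q₂, κ, e, c₁, hκ, mul_nonneg hB hC₁, hq₂, hc₁, fun N z hz => ?_⟩
  have hdec0 : 0 ≤ X.offDecayAt p κ (2 * Module.finrank ℚ X.E) N := X.offDecayAt_nonneg p κ _ N
  have hterm : ∀ w : {w : X.LineTuple // X.orbitOf w ∉ X.CrossFamily xm},
      ‖X.summand D.Φ D.cf (loc N) w.1 z‖ₑ ≤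
        ENNReal.ofReal (B * C₁ * q₂ ^ N * X.offDecayAt p κ (2 * Module.finrank ℚ X.E) N) *
          S'.indicator (fun v => ENNReal.ofReal (X.invMajorant D e c₁ v z)) w.1 := by
    intro w
    by_cases hc : X.coefQ D.cf (loc N) (X.rep w.1) = 0
    · unfold summand
      rw [hc, zero_mul, enorm_zero]
      exact zero_le
    · have hw : w.1 ∈ S' := hsuppIn N w.1 hc
      rw [Set.indicator_of_mem hw, ← ofReal_norm, ← ENNReal.ofReal_mul (by positivity)]
      refine ENNReal.ofReal_le_ofReal ?_
      have h := hclass N w.1 z hz w.2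
      have hde : X.offFamilyDecay p κ N = X.offDecayAt p κ (2 * Module.finrank ℚ X.E) N := rfl
      rw [hde] at h
      calc ‖X.summand D.Φ D.cf (loc N) w.1 z‖
          ≤ B * q₂ ^ N * X.invMajorant D e c₁ w.1 z * (C₁ * X.offDecayAt p κ (2 * Module.finrank ℚ X.E) N) := h
        _ = B * C₁ * q₂ ^ N * X.offDecayAt p κ (2 * Module.finrank ℚ X.E) N * X.invMajorant D e c₁ w.1 z := by
            ring
  calc X.offSetDensity D (loc N) (X.CrossFamily xm) z
      = ∑' w : {w : X.LineTuple // X.orbitOf w ∉ X.CrossFamily xm}, ‖X.summand D.Φ D.cf (loc N) w.1 z‖ₑ := rfl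
    _ ≤ ∑' w : {w : X.LineTuple // X.orbitOf w ∉ X.CrossFamily xm},
          ENNReal.ofReal (B * C₁ * q₂ ^ N * X.offDecayAt p κ (2 * Module.finrank ℚ X.E) N) *
            S'.indicator (fun v => ENNReal.ofReal (X.invMajorant D e c₁ v z)) w.1 := ENNReal.tsum_le_tsum hterm
    _ = ENNReal.ofReal (B * C₁ * q₂ ^ N * X.offDecayAt p κ (2 * Module.finrank ℚ X.E) N) *
          ∑' w : {w : X.LineTuple // X.orbitOf w ∉ X.CrossFamily xm},
            S'.indicator (fun v => ENNReal.ofReal (X.invMajorant D e c₁ v z)) w.1 := ENNReal.tsum_mul_left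
    _ = ENNReal.ofReal (B * C₁ * q₂ ^ N * X.offDecayAt p κ (2 * Module.finrank ℚ X.E) N) *
          X.familyMajorantDensity D S' xm e c₁ z := by
        unfold familyMajorantDensity
        rw [X.tsum_familySet_eq S' xm (fun v => ENNReal.ofReal (X.invMajorant D e c₁ v z))]

/-- **THE OFF-FAMILY MASS** (root `1/(2d)`): from `SuppSlot`, `GrowthInvOn`, a `Γ`-stable `S′` containing the
support, a fundamental domain `F` of `Γ` and the finite mass of the INVARIANT majorant density over `F`. -/
theorem offFamilyMass_of_growthInvOn (D : X.ThetaData)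
    (p : IsDedekindDomain.HeightOneSpectrum (RingOfIntegers X.E)) (xm : X.Tuple)
    {level : ℕ → X.Level} (loc : ∀ N, X.Tr (level N))
    (hlev : ∃ q₀ : ℕ, 1 ≤ q₀ ∧ ∀ N, X.Γ ∩ principalCongruence X.c X.H (q₀ ^ N) ⊆ (level N).1)
    (hsupp : X.SuppSlot D p xm loc) (hinv : X.GrowthInvOn D loc) {S' : Set X.LineTuple}
    (hS : X.IsGammaStable S')
    (hsuppIn : ∀ (N : ℕ) (w : X.LineTuple), X.coefQ D.cf (loc N) (X.rep w) ≠ 0 → w ∈ S') {F : Set (Fin 2 → ℂ)}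
    (hF : IsFundamentalDomainFor (ballActions X.τ₀ X.C X.Γ) F)
    (hmass : ∀ e c₁ : ℝ, 0 < c₁ → ∃ M_F : ℝ, 0 ≤ M_F ∧
      ∫⁻ z in F, X.invMajorantDensity D S' xm e c₁ z ≤ ENNReal.ofReal M_F) :
    Nonempty (X.OffSetMassExp D p (X.CrossFamily xm) level loc (2 * Module.finrank ℚ X.E)) := by
  obtain ⟨K, q₂, κ, e, c₁, hκ, hK, hq₂, hc₁, hpt⟩ :=
    X.offFamilyDensity_le_familyMajorantDensity D p xm loc hsupp hinv hsuppIn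
  obtain ⟨M_F, hMF, hμF⟩ := hmass e c₁ hc₁
  have hμF' : ∫⁻ z in F, X.familyMajorantDensity D S' xm e c₁ z ≤ ENNReal.ofReal M_F :=
    (lintegral_mono fun z => X.familyMajorantDensity_le_invMajorantDensity D S' xm e c₁ z).trans hμF
  exact X.offSetMassExp_of_invariantDensity D p (X.CrossFamily xm) loc (2 * Module.finrank ℚ X.E) hlev hF
    (X.familyMajorantDensity D S' xm e c₁) (X.familyMajorantDensity_isInvariant D hS xm e c₁) hMF hμF' hK hq₂ hκ hpt

/-- **L3.5 OFF THE CROSS FAMILY**: one summable majorant of the orbital terms off the family, uniform in the depth,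
from the per-slot support clause, the growth clause, a `Γ`-stable set containing the support, a fundamental domain
of `Γ` and the finite mass of the invariant majorant density — the inputs of the landed `term_dominated_of_growthInv`
(p674244), with `SuppSlot` for `LocS.supp`, `GrowthInvOn` for `GrowthInv` and the cross family for the main orbit. -/
theorem term_dominated_family (D : X.ThetaData)
    (p : IsDedekindDomain.HeightOneSpectrum (RingOfIntegers X.E)) (xm : X.Tuple)
    {level : ℕ → X.Level} (loc : ∀ N, X.Tr (level N))
    (hlev : ∃ q₀ : ℕ, 1 ≤ q₀ ∧ ∀ N, X.Γ ∩ principalCongruence X.c X.H (q₀ ^ N) ⊆ (level N).1)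
    (hsupp : X.SuppSlot D p xm loc) (hinv : X.GrowthInvOn D loc) {S' : Set X.LineTuple}
    (hS : X.IsGammaStable S')
    (hsuppIn : ∀ (N : ℕ) (w : X.LineTuple), X.coefQ D.cf (loc N) (X.rep w) ≠ 0 → w ∈ S') {F : Set (Fin 2 → ℂ)}
    (hF : IsFundamentalDomainFor (ballActions X.τ₀ X.C X.Γ) F)
    (hmass : ∀ e c₁ : ℝ, 0 < c₁ → ∃ M_F : ℝ, 0 ≤ M_F ∧
      ∫⁻ z in F, X.invMajorantDensity D S' xm e c₁ z ≤ ENNReal.ofReal M_F) :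
    ∃ bound : X.Orbit → ℝ, (∀ o, 0 ≤ bound o) ∧ Summable bound ∧
      ∀ N (o : X.Orbit), o ∉ X.CrossFamily xm → ‖X.term D.Φ D.cf (level N) (loc N) o‖ ≤ bound o := by
  obtain ⟨H⟩ := X.offFamilyMass_of_growthInvOn D p xm loc hlev hsupp hinv hS hsuppIn hF hmass
  have hr : 1 ≤ 2 * Module.finrank ℚ X.E := by
    have := (Module.finrank_pos : 0 < Module.finrank ℚ X.E)
    omega
  exact X.term_dominated_of_offSetMassExp D hr H

end T4Data

end Summit.Ventures.HodgeRepro.Tier4.Line3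

end
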